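import Literature.NumberTheory.DiophantineApproximation.GeneralizedPolynomialsProofs
import HarnessLib

/-!
# Averages of continuous functions of bounded generalized polynomials (Bergelson–Leibman 2007, Cor. 0.25) and the decomposition of Cor. 0.26

Topic `NumberTheory/DiophantineApproximation`; decomposition file (librarian, fact-decompose
`libsplit-37`, human 2026-08-16) for the named fact `BergelsonLeibman2007_cor_0_26` of
`GeneralizedPolynomials.lean` — V. Bergelson, A. Leibman, *Distribution of values of bounded
generalized polynomials*, Acta Math. 198 (2007) 155–230, Cor. 0.26: for every generalized
polynomial `u : ℤ → ℝ` the averages `|Φ_N|⁻¹ Σ_{n ∈ Φ_N} e^{2πiu(n)}` converge along every Følner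
sequence, to a limit not depending on it.

Printed proof (p. 167): Cor. 0.26 is Cor. 0.25 applied to the BOUNDED generalized polynomial
`{u}` and the continuous function `e^{2πix}` ("the generalized polynomial `u` is not assumed to be
bounded, but this does not matter in view of the identity `e^{2πiu(n)} = e^{2πi{u(n)}}`"), and
Cor. 0.25 — "Let `u : ℤ^d → ℝ^l` be a bounded GP mapping. For any `f ∈ C(ℝ^l)` and any Følner
sequence `{Φ_N}` in `ℤ^d`, `lim_{N→∞} |Φ_N|⁻¹ Σ_{n ∈ Φ_N} f(u(n))` exists and is equal to
`∫_S f dμ_S`" — is the immediate corollary of Theorem B (well-distribution of bounded GP mappings on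
a piecewise polynomial surface `S`), itself Theorem A (bounded generalized polynomials are
piecewise polynomial images of polynomial orbits on nilmanifolds, §§5–10) plus Leibman's
equidistribution of polynomial orbits on nilmanifolds. The reduction "Cor. 0.26 ⟸ bounded case"
is the tree's theorem `BergelsonLeibman2007_cor_0_26_of_bounded` (`GeneralizedPolynomialsProofs.lean`,
which also proves the whole abelian/Weyl layer). This file names the ONE child of the
decomposition, Cor. 0.25 for `d = 1` (vector-valued bounded GP mappings `ℤ → ℝ^l`, continuous
test functions; the limit is recorded only through its existence and Følner-independence, the
surface `S` and `μ_S` not being typed) — `BergelsonLeibman2007_cor_0_25`, a named fact (D-0014) —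
and proves the assembly `BergelsonLeibman2007_cor_0_26_holds_of` (`l = 1`, `f = e^{2πix}`,
`u ↦ {u}` via `IsGeneralizedPolynomial.fract`).

What a proof of the child needs (not in the tree): nilmanifolds `G/Γ`, polynomial sequences in
nilpotent Lie groups, Leibman 2005 (Thm. B there), and Bergelson–Leibman's Theorems A–B with the
Riemann-integrability step of their §4 (Thm. 4.2). The abelian case (`u` a polynomial, `f ∘ (· mod 1)`
continuous on the torus) is proved: `weyl_foelner_limit_torus`.

## References

* [BergelsonLeibman2007] V. Bergelson, A. Leibman, Acta Math. 198 (2007) 155–230, §0.1 (GP),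
  §0.21–0.22 (Følner sequences, well-distribution), Theorem B (§0.24), Cor. 0.25, Cor. 0.26 (p. 167).
* [Leibman2005] A. Leibman, *Pointwise convergence of ergodic averages for polynomial sequences of
  translations on a nilmanifold*, Ergodic Theory Dynam. Systems 25 (2005) 201–213, Thm. B.
-/

noncomputable section

namespace Literature.NumberTheory.DiophantineApproximation

open Filter Finset

/-- **Bergelson–Leibman 2007, Cor. 0.25 (`d = 1`; named fact).** "Let `u : ℤ^d → ℝ^l` be a bounded
GP mapping. For any `f ∈ C(ℝ^l)` and any Følner sequence `{Φ_N}` in `ℤ^d`,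
`lim_{N→∞} |Φ_N|⁻¹ Σ_{n ∈ Φ_N} f(u(n))` exists and is equal to `∫_S f dμ_S`" (`S`, `μ_S` the
piecewise polynomial surface and measure of Theorem B). Rendering for `d = 1`: for every `l`, every
family `u = (u_i)_{i < l}` of generalized polynomials `ℤ → ℝ` (`IsGeneralizedPolynomial`, §0.1)
which is bounded, and every continuous `f : ℝ^l → ℂ` (`ℝ^l = Fin l → ℝ`; complex-valued, i.e. the
printed statement for `Re f` and `Im f`), there is ONE `c ∈ ℂ` (in print `c = ∫_S f dμ_S`, whence
independent of the Følner sequence) such that `|Φ_N|⁻¹ Σ_{n ∈ Φ_N} f(u(n)) → c` along every Følner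
sequence `Φ` of `ℤ` (`IsFoelnerSeq`, §0.21). The surface `S` and the measure `μ_S` are not typed —
weaker than print. Proof in print: Theorem B (Theorem A, §§5–10, + Leibman 2005 + §4). Users take
`(h : BergelsonLeibman2007_cor_0_25)`. [cite: BergelsonLeibman2007, Cor. 0.25 (with Theorem B, §0.24)] -/
def BergelsonLeibman2007_cor_0_25 : Prop :=
  ∀ (l : ℕ) (u : Fin l → ℤ → ℝ), (∀ i, IsGeneralizedPolynomial (u i)) →
    (∃ B : ℝ, ∀ i n, |u i n| ≤ B) →
    ∀ f : (Fin l → ℝ) → ℂ, Continuous f →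
      ∃ c : ℂ, ∀ Φ : ℕ → Finset ℤ, IsFoelnerSeq Φ →
        Tendsto (fun N => ((Φ N).card : ℂ)⁻¹ * ∑ n ∈ Φ N, f (fun i => u i n)) atTop (nhds c)

/-- **Decomposition of `BergelsonLeibman2007_cor_0_26`** (Cor. 0.26) from its single child
`BergelsonLeibman2007_cor_0_25` (Cor. 0.25, `d = 1`), along the printed sentence "this does not
matter in view of the identity `e^{2πiu(n)} = e^{2πi{u(n)}}`": apply the child with `l = 1` to the
bounded generalized polynomial `{u}` (`IsGeneralizedPolynomial.fract`, values in `[0, 1)`) and the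
continuous `f(x) = e^{2πix}`, through the tree's reduction `BergelsonLeibman2007_cor_0_26_of_bounded`.
[cite: BergelsonLeibman2007, Cor. 0.26 (proof) and Cor. 0.25] -/
theorem BergelsonLeibman2007_cor_0_26_holds_of (h : BergelsonLeibman2007_cor_0_25) :
    BergelsonLeibman2007_cor_0_26 := by
  refine BergelsonLeibman2007_cor_0_26_of_bounded fun u hu hb => ?_
  have hcont : Continuous fun v : Fin 1 → ℝ =>
      Complex.exp (2 * Real.pi * Complex.I * ((v 0 : ℝ) : ℂ)) :=
    Complex.continuous_exp.comp
      (continuous_const.mul (Complex.continuous_ofReal.comp (continuous_apply 0)))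
  have hbdd : ∃ B : ℝ, ∀ (_i : Fin 1) (n : ℤ), |(fun _ : Fin 1 => u) _i n| ≤ B := by
    refine ⟨1, fun _ n => ?_⟩
    obtain ⟨h0, h1⟩ := hb n
    rw [abs_le]
    constructor <;> linarith
  obtain ⟨c, hc⟩ := h 1 (fun _ => u) (fun _ => hu) hbdd _ hcont
  exact ⟨c, fun Φ hΦ => hc Φ hΦ⟩

end Literature.NumberTheory.DiophantineApproximation

end
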